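import Literature.Topology.FourManifolds.Homogeneity
import Literature.AlgebraicTopology.Homotopy.HomotopyGroupsGeneralPosition
import HarnessLib

/-!
# Homogeneity relative to a finite set; finitely many points are moved into any open set

Topic `Literature/Topology/FourManifolds` (general differential topology). M. W. Hirsch,
*Differential Topology* (1976), Ch. 8 §3, Thm. 3.1 (`k = 0`, finitely many components: "Let
`M` be a connected `n`-manifold and `f, g : Dᵏ → M` embeddings … isotopic … realized by a
diffeotopy of `M` having compact support"; a finite set is an embedded `0`-manifold) and J. Milnor,
*Topology from the differentiable viewpoint* (1965), §4, Homogeneity Lemma ("`N ∖ y₁ ∖ ⋯` is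
connected", the classical corollary that any finite set of an `n`-manifold, `n ≥ 2`, lies in a
coordinate ball). Continues `Homogeneity.lean` (one point, `Diffeomorph.exists_isDiffeotopicToId_apply_eq_of_connectedSpace`),
with the same flow-free local pushes (`translationPush`, `AmbientIsotopy.alongChart`):

* `exists_mem_maximalAtlas_centred_source_subset` — a full-target chart of the maximal
  atlas centred at `x` with source inside a prescribed neighbourhood of `x`;
* `isPathConnected_compl_of_finite` — the complement of a finite set in a connected manifold of
  dimension `≥ 2` is path connected (iterate the tree's
  `isPathConnected_compl_singleton_of_chartedSpace`);
* `Diffeomorph.exists_apply_eq_forall_eq_of_finite` — **homogeneity relative to a finite set**: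
  for `S ⊆ M` finite and `x, y ∉ S` there is a self-diffeomorphism `P` of `M` with `P x = y` and
  `P = id` on `S` (the pushes are taken in charts disjoint from `S`, and chained over the
  connected `M ∖ S`);
* `Diffeomorph.exists_image_subset_of_finite` — **finitely many points are moved into any
  nonempty open set by a diffeomorphism**: for `F` finite and `V` open nonempty there is `P` with
  `P(F) ⊆ V` (induction on `F`).

Everything is proved; no definitions, no named facts. Written for the fact seat of
`Literature.AlgebraicGeometry.Surfaces.K3_even_intersectionForm` (to put the finitely many zeros of
an almost-framing inside one removable ball).

## References

* M. W. Hirsch, *Differential Topology*, GTM 33, Springer (1976), Ch. 8 §1 Thms. 1.3–1.4, §3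
  Thm. 3.1. [HirschDT1976]
* J. Milnor, *Topology from the differentiable viewpoint* (1965), §4, Homogeneity Lemma.
-/

open scoped Manifold ContDiff Topology
open Set Function Metric OpenPartialHomeomorph

noncomputable section

namespace Literature.Topology.FourManifolds

/-! ### Full-target charts with small source -/

section CentredChart

variable {E : Type*} [NormedAddCommGroup E] [InnerProductSpace ℝ E]
  {M : Type*} [TopologicalSpace M] [ChartedSpace E M] [IsManifold 𝓘(ℝ, E) ∞ M]

/-- Every point `x` lies in the source of a chart of the maximal smooth atlas with target all of
`E`, centred at `x` (`e x = 0`), whose source is contained in a prescribed neighbourhood `U` of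
`x`: shrink the preferred chart to a small ball and reparametrise the ball by `univBall`
(compare `exists_mem_maximalAtlas_target_eq_univ`, and the uncentred Euclidean-model
`exists_mem_maximalAtlas_target_eq_univ_source_subset` of `HalfDiscFromChart.lean`). [folklore] -/
theorem exists_mem_maximalAtlas_centred_source_subset (x : M) {U : Set M} (hU : U ∈ 𝓝 x) :
    ∃ e ∈ IsManifold.maximalAtlas 𝓘(ℝ, E) ∞ M,
      x ∈ e.source ∧ e.source ⊆ U ∧ e.target = univ ∧ e x = 0 := by
  set e₀ := chartAt E x
  -- a ball in the target whose preimage lies in `U`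
  have hW : e₀.target ∩ e₀.symm ⁻¹' U ∈ 𝓝 (e₀ x) :=
    Filter.inter_mem (e₀.open_target.mem_nhds (mem_chart_target E x))
      (e₀.continuousAt_symm (mem_chart_target E x) (by rwa [e₀.left_inv (mem_chart_source E x)]))
  obtain ⟨r, hr, hball⟩ := Metric.mem_nhds_iff.1 hW
  set u := univBall (e₀ x) r
  have hut : u.target = ball (e₀ x) r := univBall_target _ hr
  have h₀ := IsManifold.chart_mem_maximalAtlas (I := 𝓘(ℝ, E)) (n := ∞) x
  refine ⟨e₀ ≫ₕ u.symm, ?_, ?_, ?_, ?_, ?_⟩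
  · apply OpenPartialHomeomorph.mem_maximalAtlas_of_contMDiffOn
    · rw [trans_source, coe_trans, symm_source, hut]
      exact contDiffOn_univBall_symm.contMDiffOn.comp
        ((contMDiffOn_of_mem_maximalAtlas h₀).mono inter_subset_left) fun y hy => hy.2
    · rw [trans_symm_eq_symm_trans_symm, symm_symm]
      exact (contMDiffOn_symm_of_mem_maximalAtlas h₀).comp contDiff_univBall.contMDiff.contMDiffOn
        fun y hy => hy.2
  · simp only [trans_source, symm_source, hut, mem_inter_iff, mem_chart_source, mem_preimage,
      mem_ball_self hr, and_self, e₀]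
  · intro y hy
    rw [trans_source, symm_source, hut] at hy
    have hy' : e₀ y ∈ e₀.target ∩ e₀.symm ⁻¹' U := hball hy.2
    simpa [e₀.left_inv hy.1] using hy'.2
  · rw [trans_target, symm_target, univBall_source, univ_inter, eq_univ_iff_forall]
    intro y
    exact (hball (hut ▸ u.map_source (by simp [u]))).1
  · simp [u, e₀]

end CentredChart

/-! ### Complements of finite sets are connected in dimension `≥ 2` -/

section Compl

variable {E : Type*} [NormedAddCommGroup E] [NormedSpace ℝ E] [FiniteDimensional ℝ E]
  {M : Type*} [TopologicalSpace M] [ChartedSpace E M] [T2Space M]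

/-- **The complement of a finite set in a connected manifold of dimension `≥ 2` is path
connected** (Milnor 1965, §4: "`N ∖ y₁ ∖ ⋯` is connected"): remove the points one at a time, each
time from the open submanifold obtained so far (the tree's
`isPathConnected_compl_singleton_of_chartedSpace`). [folklore] -/
theorem isPathConnected_compl_of_finite [ConnectedSpace M] (h2 : 1 < Module.finrank ℝ E)
    {S : Set M} (hS : S.Finite) : IsPathConnected Sᶜ := by
  haveI := ChartedSpace.locallyPathConnectedSpace E M
  haveI : PathConnectedSpace M := pathConnectedSpace_iff_connectedSpace.mpr inferInstance
  induction S, hS using Set.Finite.induction_on with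
  | empty => simpa using (pathConnectedSpace_iff_univ (X := M)).1 inferInstance
  | @insert a S haS hSf ih =>
    -- `Sᶜ` is a path connected open submanifold; remove `a` from it
    let U : TopologicalSpace.Opens M := ⟨Sᶜ, hSf.isClosed.isOpen_compl⟩
    haveI : PathConnectedSpace U := isPathConnected_iff_pathConnectedSpace.1 ih
    have ha : a ∈ (U : Set M) := haS
    have h := Literature.AlgebraicTopology.Homotopy.isPathConnected_compl_singleton_of_chartedSpace
      (E := E) (M := U) h2 ⟨a, ha⟩
    have himg := h.image (f := ((↑) : U → M)) continuous_subtype_val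
    convert himg using 1
    ext y
    constructor
    · intro hy
      have hy' : ¬ (y = a ∨ y ∈ S) := fun h' => hy (mem_insert_iff.2 h')
      push Not at hy'
      exact ⟨⟨y, hy'.2⟩, fun h' => hy'.1 (congrArg Subtype.val (mem_singleton_iff.1 h')), rfl⟩
    · rintro ⟨z, hz, rfl⟩ hz'
      rcases mem_insert_iff.1 hz' with h' | h'
      · exact hz (mem_singleton_iff.2 (Subtype.ext h'))
      · exact z.2 h'

omit [FiniteDimensional ℝ E] [T2Space M] in
/-- A nonempty open subset of a manifold of positive dimension is infinite; in particular it is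
not covered by a finite set: `V ∖ S ≠ ∅` for `S` finite. [folklore] -/
theorem exists_mem_open_not_mem_of_finite (h1 : 0 < Module.finrank ℝ E) {V : Set M} (hV : IsOpen V)
    (hVne : V.Nonempty) {S : Set M} (hS : S.Finite) : ∃ y ∈ V, y ∉ S := by
  obtain ⟨x, hx⟩ := hVne
  haveI : Nontrivial E := Module.nontrivial_of_finrank_pos h1
  set c := chartAt E x
  -- the chart image of `V ∩ source` is a neighbourhood of `c x`, hence infinite
  have hW : c.target ∩ c.symm ⁻¹' (V ∩ c.source) ∈ 𝓝 (c x) :=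
    Filter.inter_mem (c.open_target.mem_nhds (mem_chart_target E x))
      (c.continuousAt_symm (mem_chart_target E x) (by
        rw [c.left_inv (mem_chart_source E x)]
        exact (hV.inter c.open_source).mem_nhds ⟨hx, mem_chart_source E x⟩))
  have hinf : (c.target ∩ c.symm ⁻¹' (V ∩ c.source)).Infinite := infinite_of_mem_nhds (c x) hW
  -- so it is not contained in the finite set `c '' (S ∩ source)`
  have hfin : (c '' (S ∩ c.source)).Finite := (hS.inter_of_left _).image _
  obtain ⟨z, hz, hzS⟩ := (hinf.sdiff hfin).nonempty
  refine ⟨c.symm z, hz.2.1, fun hzS' => hzS ⟨c.symm z, ⟨hzS', hz.2.2⟩, c.right_inv hz.1⟩⟩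

end Compl

/-! ### Homogeneity relative to a finite set -/

section Relative

variable {E : Type*} [NormedAddCommGroup E] [InnerProductSpace ℝ E] [FiniteDimensional ℝ E]
  [CompleteSpace E]
  {M : Type*} [TopologicalSpace M] [ChartedSpace E M] [T2Space M] [ConnectedSpace M]
  [IsManifold 𝓘(ℝ, E) ∞ M]

/-- **Homogeneity relative to a finite set** (Hirsch 1976, Ch. 8 §3, Thm. 3.1, `k = 0`: the
compactly supported diffeotopy moving one point may be chosen to fix finitely many others;
Milnor 1965, §4). Let `M` be a connected Hausdorff smooth manifold without boundary of dimension
`≥ 2`, `S ⊆ M` finite and `x, y ∉ S`. Then there is a self-diffeomorphism `P` of `M` with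
`P x = y` and `P s = s` for all `s ∈ S`. Proof: the relation "joined by a diffeomorphism fixing
`S`" is an equivalence relation on the connected open submanifold `M ∖ S`
(`isPathConnected_compl_of_finite`) with open classes — near `a ∉ S` use the translation pushes
in a full-target chart centred at `a` with source disjoint from `S`
(`exists_mem_maximalAtlas_centred_source_subset`); they are the identity off the chart.
[cite: HirschDT1976, Ch. 8 §3, Thm. 3.1 (k = 0)] -/
theorem Diffeomorph.exists_apply_eq_forall_eq_of_finite (h2 : 1 < Module.finrank ℝ E)
    {S : Set M} (hS : S.Finite) {x y : M} (hx : x ∉ S) (hy : y ∉ S) :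
    ∃ P : M ≃ₘ⟮𝓘(ℝ, E), 𝓘(ℝ, E)⟯ M, P x = y ∧ ∀ s ∈ S, P s = s := by
  -- work on the connected subspace `N = M ∖ S`
  let N : Set M := Sᶜ
  haveI : ConnectedSpace N := isConnected_iff_connectedSpace.1
    (isPathConnected_compl_of_finite (M := M) h2 hS).isConnected
  let Rel : N → N → Prop := fun a b =>
    ∃ P : M ≃ₘ⟮𝓘(ℝ, E), 𝓘(ℝ, E)⟯ M, P a = b ∧ ∀ s ∈ S, P s = s
  have htrans : IsTrans N Rel := ⟨fun a b c ⟨P, hPa, hPS⟩ ⟨Q, hQb, hQS⟩ =>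
    ⟨P.trans Q, by simp [Diffeomorph.coe_trans, hPa, hQb], fun s hs => by
      simp [Diffeomorph.coe_trans, hPS s hs, hQS s hs]⟩⟩
  haveI hsymm : Std.Symm Rel := ⟨fun a b ⟨P, hPa, hPS⟩ =>
    ⟨P.symm, by rw [← hPa, P.symm_apply_apply], fun s hs => by
      conv_lhs => rw [← hPS s hs]
      rw [P.symm_apply_apply]⟩⟩
  suffices h : Rel ⟨x, hx⟩ ⟨y, hy⟩ by
    obtain ⟨P, hP, hPS⟩ := h
    exact ⟨P, hP, hPS⟩
  refine PreconnectedSpace.induction₂ Rel (fun a => ?_) htrans ⟨x, hx⟩ ⟨y, hy⟩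
  -- a full-target chart centred at `a` with source disjoint from `S`
  have hSa : Sᶜ ∈ 𝓝 (a : M) := hS.isClosed.isOpen_compl.mem_nhds a.2
  obtain ⟨e, he, hae, heS, htarget, hea⟩ :=
    exists_mem_maximalAtlas_centred_source_subset (E := E) (a : M) hSa
  have hφ : ContMDiffOn 𝓘(ℝ, E) 𝓘(ℝ, E) ∞ e e.source := contMDiffOn_of_mem_maximalAtlas he
  have hφ' : ContMDiff 𝓘(ℝ, E) 𝓘(ℝ, E) ∞ e.symm := by
    have h := contMDiffOn_symm_of_mem_maximalAtlas he
    rwa [htarget, contMDiffOn_univ] at h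
  have hU : e.source ∩ e ⁻¹' ball (0 : E) (pushRadius E) ∈ 𝓝 (a : M) :=
    (e.isOpen_inter_preimage isOpen_ball).mem_nhds ⟨hae, by simp [hea, pushRadius_pos]⟩
  have hUN : ((↑) : N → M) ⁻¹' (e.source ∩ e ⁻¹' ball (0 : E) (pushRadius E)) ∈ 𝓝 a :=
    continuous_subtype_val.continuousAt.preimage_mem_nhds hU
  filter_upwards [hUN] with b hb
  have hv : ‖e b‖ ≤ pushRadius E := by simpa using (le_of_lt (mem_ball_zero_iff.mp hb.2))
  let G : AmbientIsotopy 𝓘(ℝ, E) M := (translationPush hv).alongChart hφ hφ' htarget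
    (R := 2) (fun t z hz => translationPushFun_eq_self (e b) t hz)
  refine ⟨G.toDiffeomorph 1, ?_, fun s hs => ?_⟩
  · change chartTransport e (translationPushFun (e b) 1) a = b
    rw [chartTransport_of_mem _ hae, hea, translationPushFun_one_apply_zero, e.left_inv hb.1]
  · change chartTransport e (translationPushFun (e b) 1) s = s
    exact chartTransport_of_not_mem _ fun hse => heS hse hs

/-- **Finitely many points of a connected manifold are moved into any nonempty open set by a
diffeomorphism** (Hirsch 1976, Ch. 8 §3, Thm. 3.1 with `k = 0`; classically: any finite subset
of a connected `n`-manifold, `n ≥ 2`, lies in a coordinate ball). For `F ⊆ M` finite and `V`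
open and nonempty there is a self-diffeomorphism `P` with `P(F) ⊆ V`: by induction on `F`, moving
one more point into `V ∖ P(F)` (nonempty, `exists_mem_open_not_mem_of_finite`) by a
diffeomorphism fixing the points already placed (`Diffeomorph.exists_apply_eq_forall_eq_of_finite`).
[cite: HirschDT1976, Ch. 8 §3, Thm. 3.1 (k = 0)] -/
theorem Diffeomorph.exists_image_subset_of_finite (h2 : 1 < Module.finrank ℝ E)
    {F : Set M} (hF : F.Finite) {V : Set M} (hV : IsOpen V) (hVne : V.Nonempty) :
    ∃ P : M ≃ₘ⟮𝓘(ℝ, E), 𝓘(ℝ, E)⟯ M, P '' F ⊆ V := by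
  induction F, hF using Set.Finite.induction_on with
  | empty => exact ⟨Diffeomorph.refl _ _ _, by simp⟩
  | @insert a F haF hFf ih =>
    obtain ⟨P₀, hP₀⟩ := ih
    -- a free target in `V`, off the points already placed
    obtain ⟨y, hyV, hyS⟩ := exists_mem_open_not_mem_of_finite (M := M) (zero_lt_one.trans h2)
      hV hVne (hFf.image P₀)
    have hbS : P₀ a ∉ P₀ '' F := fun ⟨a', ha', h⟩ => haF (P₀.injective h ▸ ha')
    obtain ⟨Q, hQ, hQS⟩ := Diffeomorph.exists_apply_eq_forall_eq_of_finite (M := M) h2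
      (hFf.image P₀) hbS hyS
    refine ⟨P₀.trans Q, ?_⟩
    rw [image_insert_eq, insert_subset_iff]
    refine ⟨?_, ?_⟩
    · simpa [Diffeomorph.coe_trans, hQ] using hyV
    · rintro _ ⟨z, hz, rfl⟩
      have h := hQS (P₀ z) (mem_image_of_mem _ hz)
      simp only [Diffeomorph.coe_trans, comp_apply, h]
      exact hP₀ (mem_image_of_mem _ hz)

/-- **Euclidean-model form** (`ℝⁿ`-charted `N`, model `𝓡 n`, `n ≥ 2`): finitely many points of a
connected closed or open manifold are moved into any nonempty open set by a diffeomorphism.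
[cite: HirschDT1976, Ch. 8 §3, Thm. 3.1 (k = 0)] -/
theorem Diffeomorph.exists_image_subset_of_finite_euclidean {n : ℕ} (hn : 2 ≤ n) (N : Type*)
    [TopologicalSpace N] [T2Space N] [ConnectedSpace N] [ChartedSpace (EuclideanSpace ℝ (Fin n)) N]
    [IsManifold (𝓡 n) ∞ N] {F : Set N} (hF : F.Finite) {V : Set N} (hV : IsOpen V)
    (hVne : V.Nonempty) : ∃ P : N ≃ₘ⟮𝓡 n, 𝓡 n⟯ N, P '' F ⊆ V :=
  Diffeomorph.exists_image_subset_of_finite (by rw [finrank_euclideanSpace_fin]; omega) hF hV hVne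

end Relative

end Literature.Topology.FourManifolds

end
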